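import Literature.Analysis.Complex.HalfPlaneQuasiGeodesic
import Literature.Analysis.Complex.KoebeQuarterProofs
import Literature.Analysis.Complex.HalfPlaneDistortion
import Mathlib.Analysis.SpecialFunctions.Complex.LogDeriv
import Mathlib.Analysis.SpecialFunctions.Complex.Arg
import Mathlib.Analysis.InnerProductSpace.Calculus
import Mathlib.Analysis.Complex.UpperHalfPlane.Topology
import HarnessLib

/-!
# Koebe's theorem along paths of `ℍ`: the distance inequality for a conformal map onto a domain

Support (complex analysis) for the sector claim of [LSW] Lemma 6.3 (G. F. Lawler, O. Schramm,
W. Werner, *Conformal restriction: the chordal case* (2003), proof of Lemma 6.3), hyperbolic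
route of `Literature/Analysis/Complex/HalfPlaneQuasiGeodesic.lean`. Let `f` be holomorphic and
injective on the open upper half-plane `ℍ` and let `z₀ ∉ f(ℍ)`.

* `QuasiGeodesic.im_mul_norm_deriv_le` — `Im w · |f'(w)|/4 ≤ |f(w) - z₀|` on `ℍ`, by Koebe's
  one-quarter theorem (`koebeQuarter_holds`, rescaled to the disc `B(w, Im w) ⊆ ℍ` exactly as in
  `Literature.Probability.RandomPlanarGeometry.ball_subset_image_of_injOn_ball` /
  `Loewner.mul_norm_deriv_div_four_le_im`): the pull-back of the hyperbolic metric of `ℍ`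
  dominates `|dz|/(4|z - z₀|)`;
* `QuasiGeodesic.abs_log_sub_log_le_of_path` — so along a `C¹` path `c` of `ℍ` with hyperbolic
  speed `|c'|/Im c ≤ m'`, `|log|f(c t) - z₀| - log|f(c s) - z₀|| ≤ 4 (m t - m s)`;
* `QuasiGeodesic.abs_log_sub_log_le` — the **distance inequality**: for `a, b ∈ ℍ`,
  `|log|f b - z₀| - log|f a - z₀|| ≤ 4 (crown (arg a) + |log|a| - log|b|| + crown (arg b))`,
  by the circle–axis–circle path from `a` to `b` (Jordan's inequality on the circular arcs,
  `crown ψ = (π/2) log(π/(2 min(ψ, π - ψ)))`);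
* `QuasiGeodesic.hasDerivAt_arg_comp`, `hasDerivAt_neg_log_norm_comp`, `norm_div_eq_sin_mul` —
  the polar coordinates `arg w`, `-log|w|` of a `C¹` curve `w` of `ℍ` have derivatives
  `Im(w'/w)`, `-Re(w'/w)`, of size `≤ |w'|/|w| = sin(arg w) · |w'|/Im w`.

## References

* Ch. Pommerenke, *Boundary Behaviour of Conformal Maps*, Springer (1992), Cor. 1.4 (Koebe),
  §4.5. [PommerenkeBBCM1992]
* G. F. Lawler, O. Schramm, W. Werner, *Conformal restriction: the chordal case* (2003), proof of
  Lemma 6.3. [LawlerSchrammWerner2003Restriction]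
-/

noncomputable section

open Set Filter Metric Real Topology
open UpperHalfPlane (upperHalfPlaneSet isOpen_upperHalfPlaneSet)
open scoped ComplexConjugate RealInnerProductSpace

namespace Literature.Analysis.Complex

namespace QuasiGeodesic

/-! ### Koebe along paths: `|d log|f - z₀|| ≤ 4 |dw|/Im w` -/

/-- **Koebe off an omitted value**: if `f` is holomorphic and injective on `ℍ` and omits `z₀`,
then `Im w · |f'(w)|/4 ≤ |f(w) - z₀|` for `w ∈ ℍ` (one-quarter theorem on `B(w, Im w) ⊆ ℍ`).
[folklore] -/
theorem im_mul_norm_deriv_le {f : ℂ → ℂ} (hf : DifferentiableOn ℂ f upperHalfPlaneSet)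
    (hinj : InjOn f upperHalfPlaneSet) {z₀ : ℂ} (hz₀ : z₀ ∉ f '' upperHalfPlaneSet) {w : ℂ}
    (hw : 0 < w.im) : w.im * ‖deriv f w‖ / 4 ≤ ‖f w - z₀‖ := by
  by_contra hlt
  rw [not_le] at hlt
  have hsub := AreaThm.ball_im_subset_upperHalfPlaneSet w
  -- Koebe's one-quarter theorem on `B(w, im w)` (rescaled from the unit disc)
  have hK : ball (f w) (w.im * ‖deriv f w‖ / 4) ⊆ f '' ball w w.im := by
    obtain ⟨hFd, hFinj, hFderiv⟩ := AreaThm.rescale_ball hw (hf.mono hsub) (hinj.mono hsub)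
    have hK := koebeQuarter_holds _ hFd hFinj
    have h0 : deriv (fun ζ ↦ f (w + w.im * ζ)) 0 = w.im * deriv f w := by
      have := hFderiv 0 (mem_ball_self one_pos); simpa using this
    simp only [mul_zero, add_zero, h0, norm_mul, Complex.norm_real, Real.norm_eq_abs,
      abs_of_pos hw] at hK
    refine (by simpa [mul_div_assoc] using hK : ball (f w) (w.im * ‖deriv f w‖ / 4) ⊆ _).trans ?_
    rintro _ ⟨ζ, hζ, rfl⟩
    refine ⟨w + w.im * ζ, ?_, rfl⟩
    rw [mem_ball, dist_eq_norm, add_sub_cancel_left, norm_mul, Complex.norm_real, Real.norm_eq_abs,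
      abs_of_pos hw]
    rw [mem_ball_zero_iff] at hζ
    nlinarith
  have hmem : z₀ ∈ ball (f w) (w.im * ‖deriv f w‖ / 4) := by
    rw [mem_ball, dist_comm, dist_eq_norm]; exact hlt
  obtain ⟨z, hz, hfz⟩ := hK hmem
  exact hz₀ ⟨z, hsub hz, hfz⟩

/-- Derivative of `log ‖F‖` along a real curve: `⟪F, F'⟫/‖F‖²`, of size `≤ ‖F'‖/‖F‖`.
[folklore] -/
theorem hasDerivAt_log_norm {F : ℝ → ℂ} {F' : ℂ} {θ : ℝ} (hF : HasDerivAt F F' θ) (h0 : F θ ≠ 0) :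
    HasDerivAt (fun θ ↦ Real.log ‖F θ‖) (⟪F θ, F'⟫ / ‖F θ‖ ^ 2) θ ∧
      |⟪F θ, F'⟫ / ‖F θ‖ ^ 2| ≤ ‖F'‖ / ‖F θ‖ := by
  have hn : 0 < ‖F θ‖ := norm_pos_iff.2 h0
  have h1 := (hF.norm_sq.log (pow_ne_zero 2 hn.ne')).const_mul (1 / 2)
  constructor
  · have heq : (fun θ ↦ Real.log ‖F θ‖) = fun θ ↦ 1 / 2 * Real.log (‖F θ‖ ^ 2) := by
      funext t
      rw [Real.log_pow]; ring
    rw [heq]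
    refine h1.congr_deriv ?_
    field_simp
  · rw [abs_div, abs_of_pos (by positivity : 0 < ‖F θ‖ ^ 2), div_le_div_iff₀ (by positivity) hn]
    have := abs_real_inner_le_norm (F θ) F'
    nlinarith [norm_nonneg F']

/-- **Koebe along a path**: for a `C¹` path `c : [s, t] → ℍ` whose hyperbolic speed is bounded by
the derivative of `m` (`|c'|/Im c ≤ m'`), `|log|f(c t) - z₀| - log|f(c s) - z₀|| ≤ 4 (m t - m s)`.
[folklore] -/
theorem abs_log_sub_log_le_of_path {f : ℂ → ℂ} (hf : DifferentiableOn ℂ f upperHalfPlaneSet)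
    (hinj : InjOn f upperHalfPlaneSet) {z₀ : ℂ} (hz₀ : z₀ ∉ f '' upperHalfPlaneSet)
    {c c' : ℝ → ℂ} {m m' : ℝ → ℝ} {s t : ℝ} (hst : s ≤ t)
    (hc : ∀ θ ∈ Icc s t, HasDerivAt c (c' θ) θ) (hcH : ∀ θ ∈ Icc s t, 0 < (c θ).im)
    (hm : ∀ θ ∈ Icc s t, HasDerivAt m (m' θ) θ) (hle : ∀ θ ∈ Icc s t, ‖c' θ‖ / (c θ).im ≤ m' θ) :
    |Real.log ‖f (c t) - z₀‖ - Real.log ‖f (c s) - z₀‖| ≤ 4 * (m t - m s) := by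
  -- the function `G θ = log ‖f (c θ) - z₀‖` and its derivative
  have hF : ∀ θ ∈ Icc s t, HasDerivAt (fun θ ↦ f (c θ) - z₀) (deriv f (c θ) * c' θ) θ := by
    intro θ hθ
    have hd : HasDerivAt f (deriv f (c θ)) (c θ) :=
      (hf.differentiableAt (isOpen_upperHalfPlaneSet.mem_nhds (hcH θ hθ))).hasDerivAt
    exact (hd.comp θ (hc θ hθ)).sub_const z₀
  have hF0 : ∀ θ ∈ Icc s t, f (c θ) - z₀ ≠ 0 := fun θ hθ h ↦
    hz₀ ⟨c θ, hcH θ hθ, (sub_eq_zero.1 h)⟩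
  have hG : ∀ θ ∈ Icc s t, HasDerivAt (fun θ ↦ Real.log ‖f (c θ) - z₀‖)
      (⟪f (c θ) - z₀, deriv f (c θ) * c' θ⟫ / ‖f (c θ) - z₀‖ ^ 2) θ :=
    fun θ hθ ↦ (hasDerivAt_log_norm (hF θ hθ) (hF0 θ hθ)).1
  have hGle : ∀ θ ∈ Icc s t,
      |⟪f (c θ) - z₀, deriv f (c θ) * c' θ⟫ / ‖f (c θ) - z₀‖ ^ 2| ≤ 4 * m' θ := by
    intro θ hθ
    have h1 := (hasDerivAt_log_norm (hF θ hθ) (hF0 θ hθ)).2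
    have hK := im_mul_norm_deriv_le hf hinj hz₀ (hcH θ hθ)
    have hn : 0 < ‖f (c θ) - z₀‖ := norm_pos_iff.2 (hF0 θ hθ)
    have him := hcH θ hθ
    refine h1.trans ?_
    rw [norm_mul, div_le_iff₀ hn]
    have h2 : ‖deriv f (c θ)‖ ≤ 4 * ‖f (c θ) - z₀‖ / (c θ).im := by
      rw [le_div_iff₀ him]; linarith
    have h3 : ‖c' θ‖ ≤ m' θ * (c θ).im := by
      have := hle θ hθ; rwa [div_le_iff₀ him] at this
    calc ‖deriv f (c θ)‖ * ‖c' θ‖ ≤ (4 * ‖f (c θ) - z₀‖ / (c θ).im) * (m' θ * (c θ).im) :=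
          mul_le_mul h2 h3 (norm_nonneg _) (by positivity)
      _ = 4 * m' θ * ‖f (c θ) - z₀‖ := by field_simp
  have := abs_sub_le_of_abs_deriv_le hst hG (fun θ hθ ↦ (hm θ hθ).const_mul 4) hGle
  linarith

/-! ### The circle–axis–circle path and the distance inequality -/

/-- A point of `ℍ` has argument in `(0, π)`. [folklore] -/
theorem arg_mem_Ioo_of_im_pos {a : ℂ} (ha : 0 < a.im) : Complex.arg a ∈ Ioo 0 π := by
  refine ⟨lt_of_le_of_ne (Complex.arg_nonneg_iff.2 ha.le) ?_, lt_of_le_of_ne (Complex.arg_le_pi a) ?_⟩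
  · intro h
    have := Complex.arg_eq_zero_iff.1 h.symm
    linarith [this.2]
  · intro h
    have := Complex.arg_eq_pi_iff.1 h
    linarith [this.2]

/-- **The circular piece**: along the arc of `|w| = ρ` from the point of argument `ψ` to the
top `iρ`, parametrised as `θ ↦ ρ e^{i(σθ + τ₀)}` on `[ψ', π/2]` (`(σ, τ₀) = (1, 0)` or `(-1, π)`,
`sin(σθ + τ₀) = sin θ`), the hyperbolic speed is `1/sin θ ≤ π/(2θ)` (Jordan), so
`|log|f(iρ) - z₀| - log|f(ρe^{i(σψ' + τ₀)}) - z₀|| ≤ 4 (π/2) log(π/(2ψ'))`. [folklore] -/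
theorem abs_log_sub_log_le_arc {f : ℂ → ℂ} (hf : DifferentiableOn ℂ f upperHalfPlaneSet)
    (hinj : InjOn f upperHalfPlaneSet) {z₀ : ℂ} (hz₀ : z₀ ∉ f '' upperHalfPlaneSet)
    {ρ ψ' σ τ₀ : ℝ} (hρ : 0 < ρ) (hψ'0 : 0 < ψ') (hψ' : ψ' ≤ π / 2) (hσ : |σ| = 1)
    (hsin : ∀ θ, Real.sin (σ * θ + τ₀) = Real.sin θ) (htop : Real.cos (σ * (π / 2) + τ₀) = 0) :
    |Real.log ‖f (ρ * Complex.I) - z₀‖ -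
        Real.log ‖f (ρ * Complex.exp ((σ * ψ' + τ₀ : ℝ) * Complex.I)) - z₀‖| ≤
      4 * (π / 2 * Real.log (π / (2 * ψ'))) := by
  set c : ℝ → ℂ := fun θ ↦ ρ * Complex.exp ((σ * θ + τ₀ : ℝ) * Complex.I) with hc
  set c' : ℝ → ℂ := fun θ ↦ ρ * (Complex.exp ((σ * θ + τ₀ : ℝ) * Complex.I) * ((σ : ℂ) * Complex.I))
    with hc'
  have hcd : ∀ θ, HasDerivAt c (c' θ) θ := by
    intro θ
    have h1 : HasDerivAt (fun θ : ℝ ↦ ((σ * θ + τ₀ : ℝ) : ℂ) * Complex.I) ((σ : ℂ) * Complex.I) θ := by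
      have h2 : HasDerivAt (fun θ : ℝ ↦ σ * θ + τ₀) σ θ := by
        simpa using ((hasDerivAt_id θ).const_mul σ).add_const τ₀
      have h3 := h2.ofReal_comp.mul_const Complex.I
      simpa using h3
    have h4 := h1.cexp.const_mul (ρ : ℂ)
    simpa [hc, hc'] using h4
  have hcim : ∀ θ, (c θ).im = ρ * Real.sin θ := by
    intro θ
    rw [hc]
    simp only
    rw [Complex.exp_mul_I]
    simp only [Complex.mul_im, Complex.ofReal_re, Complex.ofReal_im, Complex.add_re, Complex.add_im,
      Complex.mul_re, Complex.I_re, Complex.I_im, Complex.cos_ofReal_im, Complex.sin_ofReal_re,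
      Complex.sin_ofReal_im, Complex.cos_ofReal_re]
    rw [hsin θ]; ring
  have hcn : ∀ θ, ‖c' θ‖ = ρ := by
    intro θ
    rw [hc']
    simp only [norm_mul, Complex.norm_real, Complex.norm_exp_ofReal_mul_I, Complex.norm_I,
      Real.norm_eq_abs, hσ, abs_of_pos hρ]
    ring
  have hI : Icc ψ' (π / 2) ⊆ Ioc 0 (π / 2) := fun θ hθ ↦ ⟨hψ'0.trans_le hθ.1, hθ.2⟩
  have hcH : ∀ θ ∈ Icc ψ' (π / 2), 0 < (c θ).im := by
    intro θ hθ
    rw [hcim]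
    exact mul_pos hρ (Real.sin_pos_of_pos_of_lt_pi (hI hθ).1 (by linarith [(hI hθ).2, Real.pi_pos]))
  have hm : ∀ θ ∈ Icc ψ' (π / 2), HasDerivAt (fun θ ↦ π / 2 * Real.log θ) (π / 2 * (1 / θ)) θ := by
    intro θ hθ
    have := (Real.hasDerivAt_log (hI hθ).1.ne').const_mul (π / 2)
    simpa using this
  have hle : ∀ θ ∈ Icc ψ' (π / 2), ‖c' θ‖ / (c θ).im ≤ π / 2 * (1 / θ) := by
    intro θ hθ
    have hθ0 := (hI hθ).1
    have hs : 0 < Real.sin θ := Real.sin_pos_of_pos_of_lt_pi hθ0 (by linarith [(hI hθ).2, Real.pi_pos])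
    have hJ : 2 / π * θ ≤ Real.sin θ := Real.mul_le_sin hθ0.le hθ.2
    rw [hcn, hcim, div_le_iff₀ (mul_pos hρ hs)]
    calc ρ = π / 2 * (1 / θ) * (ρ * (2 / π * θ)) := by field_simp
      _ ≤ π / 2 * (1 / θ) * (ρ * Real.sin θ) := by gcongr
  have h := abs_log_sub_log_le_of_path hf hinj hz₀ hψ' (fun θ _ ↦ hcd θ) hcH hm hle
  -- endpoints
  have htopc : c (π / 2) = ρ * Complex.I := by
    have hs2 : Real.sin (σ * (π / 2) + τ₀) = 1 := by rw [hsin, Real.sin_pi_div_two]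
    rw [hc]
    simp only
    rw [Complex.exp_mul_I, ← Complex.ofReal_cos, ← Complex.ofReal_sin, htop, hs2]
    simp
  rw [htopc] at h
  have hlog : π / 2 * Real.log (π / (2 * ψ')) = π / 2 * Real.log (π / 2) - π / 2 * Real.log ψ' := by
    rw [show π / (2 * ψ') = π / 2 / ψ' by ring, Real.log_div (by positivity) hψ'0.ne']
    ring
  rw [← hlog] at h
  exact h

/-- **The circular piece from a point of `ℍ`**: `|log|f(i|a|) - z₀| - log|f a - z₀|| ≤ 4 crown (arg a)`.
[folklore] -/
theorem abs_log_sub_log_le_crown {f : ℂ → ℂ} (hf : DifferentiableOn ℂ f upperHalfPlaneSet)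
    (hinj : InjOn f upperHalfPlaneSet) {z₀ : ℂ} (hz₀ : z₀ ∉ f '' upperHalfPlaneSet) {a : ℂ}
    (ha : 0 < a.im) :
    |Real.log ‖f (‖a‖ * Complex.I) - z₀‖ - Real.log ‖f a - z₀‖| ≤ 4 * crown (Complex.arg a) := by
  have hρ : 0 < ‖a‖ := norm_pos_iff.2 (by rintro rfl; simp at ha)
  have hψ := arg_mem_Ioo_of_im_pos ha
  set ψ := Complex.arg a with hψdef
  rcases le_or_gt ψ (π / 2) with hle | hgt
  · -- `(σ, τ₀) = (1, 0)`
    have h := abs_log_sub_log_le_arc hf hinj hz₀ (σ := 1) (τ₀ := 0) hρ hψ.1 hle (by simp)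
      (fun θ ↦ by simp) (by simp)
    have ha' : (‖a‖ : ℂ) * Complex.exp ((1 * ψ + 0 : ℝ) * Complex.I) = a := by
      rw [one_mul, add_zero, hψdef]; exact Complex.norm_mul_exp_arg_mul_I a
    rw [ha'] at h
    rw [crown_of_le hle]
    exact h
  · -- `(σ, τ₀) = (-1, π)`
    have hψ'0 : 0 < π - ψ := by linarith [hψ.2]
    have hψ'le : π - ψ ≤ π / 2 := by linarith
    have h := abs_log_sub_log_le_arc hf hinj hz₀ (σ := -1) (τ₀ := π) hρ hψ'0 hψ'le (by simp)
      (fun θ ↦ by rw [show -1 * θ + π = π - θ by ring, Real.sin_pi_sub])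
      (by rw [show -1 * (π / 2) + π = π / 2 by ring, Real.cos_pi_div_two])
    have ha' : (‖a‖ : ℂ) * Complex.exp ((-1 * (π - ψ) + π : ℝ) * Complex.I) = a := by
      rw [show -1 * (π - ψ) + π = ψ by ring, hψdef]; exact Complex.norm_mul_exp_arg_mul_I a
    rw [ha'] at h
    have hcr : crown ψ = π / 2 * Real.log (π / (2 * (π - ψ))) := by
      unfold crown; rw [min_eq_right (by linarith)]
    rw [hcr]
    exact h

/-- **The vertical piece**: `|log|f(iρ₂) - z₀| - log|f(iρ₁) - z₀|| ≤ 4 |log ρ₂ - log ρ₁|`.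
[folklore] -/
theorem abs_log_sub_log_le_axis {f : ℂ → ℂ} (hf : DifferentiableOn ℂ f upperHalfPlaneSet)
    (hinj : InjOn f upperHalfPlaneSet) {z₀ : ℂ} (hz₀ : z₀ ∉ f '' upperHalfPlaneSet) {ρ₁ ρ₂ : ℝ}
    (h₁ : 0 < ρ₁) (h₂ : 0 < ρ₂) :
    |Real.log ‖f (ρ₂ * Complex.I) - z₀‖ - Real.log ‖f (ρ₁ * Complex.I) - z₀‖| ≤
      4 * |Real.log ρ₂ - Real.log ρ₁| := by
  -- the vertical segment `t ↦ it`
  have key : ∀ {r₁ r₂ : ℝ}, 0 < r₁ → r₁ ≤ r₂ →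
      |Real.log ‖f (r₂ * Complex.I) - z₀‖ - Real.log ‖f (r₁ * Complex.I) - z₀‖| ≤
        4 * (Real.log r₂ - Real.log r₁) := by
    intro r₁ r₂ hr₁ hr₁₂
    have hcd : ∀ t : ℝ, HasDerivAt (fun t : ℝ ↦ (t : ℂ) * Complex.I) Complex.I t := fun t ↦ by
      simpa using (Complex.ofRealCLM.hasDerivAt (x := t)).mul_const Complex.I
    have hI : ∀ t ∈ Icc r₁ r₂, 0 < t := fun t ht ↦ hr₁.trans_le ht.1
    refine abs_log_sub_log_le_of_path hf hinj hz₀ hr₁₂ (fun t _ ↦ hcd t)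
      (fun t ht ↦ by simpa using hI t ht) (fun t ht ↦ Real.hasDerivAt_log (hI t ht).ne') ?_
    intro t ht
    simp only [Complex.norm_I, Complex.mul_im, Complex.ofReal_re, Complex.I_im, mul_one,
      Complex.ofReal_im, Complex.I_re, mul_zero, add_zero]
    rw [one_div]
  rcases le_total ρ₁ ρ₂ with h | h
  · rw [abs_of_nonneg (sub_nonneg.2 (Real.log_le_log h₁ h))]
    exact key h₁ h
  · rw [abs_sub_comm, abs_sub_comm (Real.log ρ₂), abs_of_nonneg (sub_nonneg.2 (Real.log_le_log h₂ h))]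
    exact key h₂ h

/-- **The distance inequality.** For `f` holomorphic and injective on `ℍ` omitting `z₀`, and
`a, b ∈ ℍ`: `|log|f b - z₀| - log|f a - z₀|| ≤ 4 (crown (arg a) + |log|a| - log|b|| + crown (arg b))`
— the hyperbolic length of the circle–axis–circle path from `a` to `b` dominates a quarter of
the logarithmic distance of the images from `z₀`. [folklore] -/
theorem abs_log_sub_log_le {f : ℂ → ℂ} (hf : DifferentiableOn ℂ f upperHalfPlaneSet)
    (hinj : InjOn f upperHalfPlaneSet) {z₀ : ℂ} (hz₀ : z₀ ∉ f '' upperHalfPlaneSet) {a b : ℂ}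
    (ha : 0 < a.im) (hb : 0 < b.im) :
    |Real.log ‖f b - z₀‖ - Real.log ‖f a - z₀‖| ≤
      4 * (crown (Complex.arg a) + |Real.log ‖a‖ - Real.log ‖b‖| + crown (Complex.arg b)) := by
  have hρa : 0 < ‖a‖ := norm_pos_iff.2 (by rintro rfl; simp at ha)
  have hρb : 0 < ‖b‖ := norm_pos_iff.2 (by rintro rfl; simp at hb)
  have h1 := abs_log_sub_log_le_crown hf hinj hz₀ ha
  have h2 := abs_log_sub_log_le_crown hf hinj hz₀ hb
  have h3 := abs_log_sub_log_le_axis hf hinj hz₀ hρa hρb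
  rw [abs_sub_comm] at h2
  rw [abs_sub_comm (Real.log ‖a‖)]
  calc |Real.log ‖f b - z₀‖ - Real.log ‖f a - z₀‖|
      = |(Real.log ‖f b - z₀‖ - Real.log ‖f (‖b‖ * Complex.I) - z₀‖) +
          (Real.log ‖f (‖b‖ * Complex.I) - z₀‖ - Real.log ‖f (‖a‖ * Complex.I) - z₀‖) +
          (Real.log ‖f (‖a‖ * Complex.I) - z₀‖ - Real.log ‖f a - z₀‖)| := by ring_nf
    _ ≤ |Real.log ‖f b - z₀‖ - Real.log ‖f (‖b‖ * Complex.I) - z₀‖| +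
          |Real.log ‖f (‖b‖ * Complex.I) - z₀‖ - Real.log ‖f (‖a‖ * Complex.I) - z₀‖| +
          |Real.log ‖f (‖a‖ * Complex.I) - z₀‖ - Real.log ‖f a - z₀‖| := abs_add_three _ _ _
    _ ≤ 4 * crown (Complex.arg b) + 4 * |Real.log ‖b‖ - Real.log ‖a‖| + 4 * crown (Complex.arg a) := by
          gcongr
    _ = 4 * (crown (Complex.arg a) + |Real.log ‖b‖ - Real.log ‖a‖| + crown (Complex.arg b)) := by ring

/-! ### Polar coordinates of a `C¹` curve of `ℍ` -/

/-- `|w'|/|w| = sin(arg w) · |w'|/Im w` for `w ∈ ℍ`. [folklore] -/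
theorem norm_div_eq_sin_mul {w w' : ℂ} (hw : 0 < w.im) :
    ‖w'‖ / ‖w‖ = Real.sin (Complex.arg w) * (‖w'‖ / w.im) := by
  have hn : 0 < ‖w‖ := norm_pos_iff.2 (by rintro rfl; simp at hw)
  rw [Complex.sin_arg]
  field_simp

/-- **Derivative of the argument along a curve of `ℍ`**: `(arg w)' = Im(w'/w)`, with
`|Im(w'/w)| ≤ sin(arg w) · |w'|/Im w`. [folklore] -/
theorem hasDerivAt_arg_comp {w : ℝ → ℂ} {w' : ℂ} {x : ℝ} (hw : HasDerivAt w w' x)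
    (hx : 0 < (w x).im) :
    HasDerivAt (fun x ↦ Complex.arg (w x)) ((w' / w x).im) x ∧
      |(w' / w x).im| ≤ Real.sin (Complex.arg (w x)) * (‖w'‖ / (w x).im) := by
  have hsl : w x ∈ Complex.slitPlane := Complex.mem_slitPlane_iff.2 (Or.inr hx.ne')
  have h1 := hw.clog_real hsl
  constructor
  · have h2 := Complex.imCLM.hasFDerivAt.comp_hasDerivAt x h1
    have heq : (fun x ↦ Complex.arg (w x)) = (⇑Complex.imCLM ∘ fun t ↦ Complex.log (w t)) := by
      funext t; simp [Complex.log_im]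
    rw [heq]
    simpa using h2
  · rw [← norm_div_eq_sin_mul hx, ← norm_div]
    exact Complex.abs_im_le_norm _

/-- **Derivative of `-log |w|` along a curve of `ℍ`**: `(-log|w|)' = -Re(w'/w)`, with
`|Re(w'/w)| ≤ sin(arg w) · |w'|/Im w`. [folklore] -/
theorem hasDerivAt_neg_log_norm_comp {w : ℝ → ℂ} {w' : ℂ} {x : ℝ} (hw : HasDerivAt w w' x)
    (hx : 0 < (w x).im) :
    HasDerivAt (fun x ↦ -Real.log ‖w x‖) (-(w' / w x).re) x ∧
      |(-(w' / w x).re)| ≤ Real.sin (Complex.arg (w x)) * (‖w'‖ / (w x).im) := by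
  have hsl : w x ∈ Complex.slitPlane := Complex.mem_slitPlane_iff.2 (Or.inr hx.ne')
  have h1 := hw.clog_real hsl
  constructor
  · have h2 := Complex.reCLM.hasFDerivAt.comp_hasDerivAt x h1
    have h3 : HasDerivAt (fun x ↦ Real.log ‖w x‖) ((w' / w x).re) x := by
      have heq : (fun x ↦ Real.log ‖w x‖) = (⇑Complex.reCLM ∘ fun t ↦ Complex.log (w t)) := by
        funext t; simp [Complex.log_re]
      rw [heq]
      simpa using h2
    exact h3.fun_neg
  · rw [abs_neg, ← norm_div_eq_sin_mul hx, ← norm_div]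
    exact Complex.abs_re_le_norm _

end QuasiGeodesic

end Literature.Analysis.Complex
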